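import Mathlib.Order.Cover
import Mathlib.Order.Grade
import Mathlib.Order.Monotone.Basic
import Mathlib.Data.Set.Card
import Mathlib.Data.Finset.Grade
import Mathlib.Data.List.Chain
import Mathlib.Logic.Relation
import HarnessLib

/-!
# Discrete Morse functions on a face poset (Forman)

Topic `Literature/AlgebraicTopology/DiscreteMorseTheory`. Forman's discrete Morse theory
[Forman1998] attaches to a finite CW complex `M` with set of cells `K` the notions of a
*discrete Morse function* `f : K → ℝ` (Def. 2.1), its *critical cells* (Def. 2.2), its *discrete
gradient vector field* `V_f` (Def. 6.1), general *discrete vector fields* `V` and their `V`-*paths*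
(Def. 9.1, 9.2), and the acyclicity condition "no non-stationary closed `V`-path" which
characterises gradients (Thm. 9.3). When `M` is a **regular** CW complex (every face is regular,
[Forman1998, Def. 1.1]; this covers simplicial, polyhedral and cubical complexes) these notions
only depend on the **face poset** of `M` — the cells ordered by `σ < τ :↔ σ ≠ τ ∧ σ ⊆ closure τ` —
in which "`τ` is a `(p+1)`-cell having the `p`-cell `σ` as a face" is exactly the covering
relation `σ ⋖ τ` (the face poset of a regular CW complex is graded by dimension). This file
formalises that combinatorial core for an arbitrary preorder `α` of "cells" and an arbitrary
preorder `β` of values (Forman: `β = ℝ`; the statements comparing values of incomparable cells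
need `β` linearly ordered). It is also the setting of Kozlov's account of the theory through
*acyclic matchings* in Hasse diagrams of posets [Kozlov2008, §11.1.1].

## Main definitions

* `cofacetsLE f σ = {τ | σ ⋖ τ ∧ f τ ≤ f σ}` and `facetsGE f σ = {ν | ν ⋖ σ ∧ f σ ≤ f ν}`: the two
  exceptional sets whose cardinalities are bounded in [Forman1998, Def. 2.1, Def. 2.2].
* `IsDiscreteMorseFunction f`: for every cell both sets have at most one element
  [Forman1998, Def. 2.1] (printed cardinality form: `isDiscreteMorseFunction_iff_ncard_le_one`).
* `IsCritical f σ`: both sets are empty [Forman1998, Def. 2.2] (`isCritical_iff_ncard_eq_zero`,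
  `isCritical_iff_forall_lt`, `not_isCritical_iff`); `criticalCells f`; `morseNumber dim f p`, the
  number `m_p(f)` of critical cells of dimension `p` for a dimension function `dim : α → ℕ`.
* `discreteGradient f = {(σ, τ) | σ ⋖ τ ∧ f τ ≤ f σ}`: the discrete gradient vector field of `f`
  as a set of pairs of cells, orientation signs dropped [Forman1998, Def. 6.1 and §9, p. 130].
* `IsDiscreteVectorField V` for `V : Set (α × α)`: a set of cover pairs `(σ ⋖ τ)` in which no cell
  occurs twice [Forman1998, Def. 9.1] = a partial matching in the Hasse diagram
  [Kozlov2008, Def. 11.1 (1)] (`isDiscreteVectorField_iff_pairwise`); `unmatched V`, its rest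
  (critical) cells.
* `VStep V σ σ'` — one non-stationary step of a `V`-path (`(σ, τ) ∈ V`, `σ ≠ σ' ⋖ τ`),
  `IsVPath V l` [Forman1998, Def. 9.2], and `IsAcyclic V`: no non-stationary closed `V`-path
  [Forman1998, Thm. 9.3], [Kozlov2008, Def. 11.1 (2)] (`isAcyclic_iff_forall_isVPath`).
* `HasCoverDiamonds α`: whenever `ν ⋖ σ ⋖ τ` there is a second cell `σ' ≠ σ` with `ν ⋖ σ' ⋖ τ` —
  the property of CW complexes with regular faces proved in [Forman1998, Thm. 1.2 (iii)]; it is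
  the only input from topology that the combinatorial lemmas below use.

## Main statements (all proved)

* `IsDiscreteMorseFunction.cofacetsLE_eq_empty_or_facetsGE_eq_empty`: [Forman1998, Lemma 2.5] —
  under `HasCoverDiamonds`, no cell has both an exceptional cofacet and an exceptional facet.
* `IsDiscreteMorseFunction.isDiscreteVectorField_discreteGradient`: the gradient of a discrete
  Morse function is a discrete vector field [Forman1998, Thm. 6.3 (1), (2); §9, p. 130].
* `isCritical_iff_mem_unmatched`, `criticalCells_eq_unmatched`: a cell is critical iff it occurs
  in no gradient pair [Forman1998, Thm. 6.3 (3)].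
* `IsDiscreteMorseFunction.lt_of_vStep`, `IsDiscreteMorseFunction.isAcyclic_discreteGradient`:
  `f` strictly decreases along non-stationary gradient steps, hence the gradient has no
  non-stationary closed paths (the "only if" half of [Forman1998, Thm. 9.3]).
* `StrictMono.isDiscreteMorseFunction`, `StrictMono.isCritical`, `isCritical_grade`: a strictly
  monotone `f`, e.g. `f = dim`, is a discrete Morse function all of whose cells are critical
  [Forman1998, §4, first paragraph].

## References

* R. Forman, *Morse theory for cell complexes*, Adv. Math. 134 (1998) 90–145,
  doi:10.1006/aima.1997.1650 — Def. 1.1, Thm. 1.2, Def. 2.1, 2.2, Lemma 2.5, §4, Def. 6.1,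
  Thm. 6.3, Def. 9.1, 9.2, Thm. 9.3. [Forman1998]
* D. Kozlov, *Combinatorial Algebraic Topology*, Springer ACM 21 (2008), §11.1.1, Def. 11.1,
  Thm. 11.2. [Kozlov2008]

## Design notes / what is NOT here

* No CW complexes appear: topology enters only through the face poset, so the file applies
  verbatim to the face poset of a finite regular CW complex (the intended use: cubical complexes
  of tori), to abstract simplicial complexes (`Finset`s ordered by inclusion) and to Kozlov's
  arbitrary posets. For NON-regular CW complexes [Forman1998, Def. 2.1] has extra clauses about
  irregular faces (`f` must increase across them) which are not modelled here.
* "At most one" is `Set.Subsingleton` and "none" is `= ∅`, so nothing is a junk value on infinite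
  posets; on a finite poset these are the printed conditions `# ≤ 1`, `# = 0`
  (`isDiscreteMorseFunction_iff_ncard_le_one`, `isCritical_iff_ncard_eq_zero`). `morseNumber`
  is a `Set.ncard` and is meaningful for finite complexes only (it is `0` on an infinite set).
* Orientations and the signs of [Forman1998, Def. 6.1] are dropped, as Forman himself does in
  §9 (p. 130): the gradient is a set of pairs, i.e. a partial matching.
* NOT here: the Morse inequalities [Forman1998, Cor. 3.6, 3.7] and the collapse / homotopy-type
  theorems (Thm. 3.3, 3.4, 10.2), which need the cellular homology of the complex; the Morse
  complex (§7, §8); and the converse half of Thm. 9.3 (an acyclic discrete vector field is the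
  gradient of some discrete Morse function; [Kozlov2008, Thm. 11.2]). They are to be vendored
  against the present vocabulary.
-/

noncomputable section

namespace Literature.AlgebraicTopology.DiscreteMorseTheory

open Set

section Definitions

variable {α : Type*} {β : Type*} [Preorder α] [Preorder β]

/-! ### Discrete Morse functions and critical cells -/

/-- The *exceptional cofacets* of a cell `σ` for `f : α → β`: the cells `τ` covering `σ` (in a
regular CW complex: the `(p+1)`-cells having the `p`-cell `σ` as a face) on which `f` does not
increase, `{τ⁽ᵖ⁺¹⁾ > σ | f τ ≤ f σ}` — the set counted in condition (i) of
[cite: Forman1998, Def. 2.1]. -/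
def cofacetsLE (f : α → β) (σ : α) : Set α := {τ | σ ⋖ τ ∧ f τ ≤ f σ}

/-- The *exceptional facets* of a cell `σ` for `f : α → β`: the cells `ν` covered by `σ` (the
`(p-1)`-faces of the `p`-cell `σ`) on which `f` does not decrease, `{ν⁽ᵖ⁻¹⁾ < σ | f ν ≥ f σ}` — the
set counted in condition (ii) of [cite: Forman1998, Def. 2.1]. -/
def facetsGE (f : α → β) (σ : α) : Set α := {ν | ν ⋖ σ ∧ f σ ≤ f ν}

/-- Membership in `cofacetsLE` unfolds definitionally. [cite: Forman1998, Def. 2.1] -/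
@[simp] theorem mem_cofacetsLE {f : α → β} {σ τ : α} :
    τ ∈ cofacetsLE f σ ↔ σ ⋖ τ ∧ f τ ≤ f σ := Iff.rfl

/-- Membership in `facetsGE` unfolds definitionally. [cite: Forman1998, Def. 2.1] -/
@[simp] theorem mem_facetsGE {f : α → β} {σ ν : α} :
    ν ∈ facetsGE f σ ↔ ν ⋖ σ ∧ f σ ≤ f ν := Iff.rfl

/-- A **discrete Morse function** on (the face poset `α` of) a regular cell complex: a function
`f : α → β` such that for every cell `σ⁽ᵖ⁾`
(i) `#{τ⁽ᵖ⁺¹⁾ > σ | f τ ≤ f σ} ≤ 1` and (ii) `#{ν⁽ᵖ⁻¹⁾ < σ | f ν ≥ f σ} ≤ 1`,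
i.e. `f` increases with dimension across covers with at most one exception above and at most
one exception below each cell. "At most one" is phrased as `Set.Subsingleton`; for a finite
complex this is the printed cardinality condition (`isDiscreteMorseFunction_iff_ncard_le_one`).
For a regular CW complex the clauses of the source about irregular faces are vacuous.
[cite: Forman1998, Def. 2.1] -/
structure IsDiscreteMorseFunction (f : α → β) : Prop where
  /-- (i) at most one cofacet `τ ⋗ σ` with `f τ ≤ f σ`. -/
  subsingleton_cofacetsLE : ∀ σ : α, (cofacetsLE f σ).Subsingleton
  /-- (ii) at most one facet `ν ⋖ σ` with `f ν ≥ f σ`. -/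
  subsingleton_facetsGE : ∀ σ : α, (facetsGE f σ).Subsingleton

/-- A cell `σ⁽ᵖ⁾` is **critical** (of index `p`, its dimension) for `f` if
(i) `#{τ⁽ᵖ⁺¹⁾ > σ | f τ ≤ f σ} = 0` and (ii) `#{ν⁽ᵖ⁻¹⁾ < σ | f ν ≥ f σ} = 0`.
[cite: Forman1998, Def. 2.2] -/
structure IsCritical (f : α → β) (σ : α) : Prop where
  /-- (i) no cofacet `τ ⋗ σ` with `f τ ≤ f σ`. -/
  cofacetsLE_eq_empty : cofacetsLE f σ = ∅
  /-- (ii) no facet `ν ⋖ σ` with `f ν ≥ f σ`. -/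
  facetsGE_eq_empty : facetsGE f σ = ∅

/-- The set of critical cells of `f`. [cite: Forman1998, Def. 2.2] -/
def criticalCells (f : α → β) : Set α := {σ | IsCritical f σ}

/-- Membership in `criticalCells` unfolds definitionally. [cite: Forman1998, Def. 2.2] -/
@[simp] theorem mem_criticalCells {f : α → β} {σ : α} : σ ∈ criticalCells f ↔ IsCritical f σ :=
  Iff.rfl

/-- The **Morse number** `m_p(f)`: the number of critical cells of `f` of dimension `p`, for a
dimension (rank) function `dim : α → ℕ` on the cells (for a graded face poset, `dim = grade ℕ`).
A `Set.ncard`, hence meaningful for finite complexes (it is `0` if that set is infinite).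
[cite: Forman1998, §3, p. 107] -/
def morseNumber (dim : α → ℕ) (f : α → β) (p : ℕ) : ℕ := {σ | IsCritical f σ ∧ dim σ = p}.ncard

/-- The definition of a discrete Morse function, unfolded. [cite: Forman1998, Def. 2.1] -/
theorem isDiscreteMorseFunction_iff {f : α → β} : IsDiscreteMorseFunction f ↔
    ∀ σ : α, (cofacetsLE f σ).Subsingleton ∧ (facetsGE f σ).Subsingleton :=
  ⟨fun h σ => ⟨h.1 σ, h.2 σ⟩, fun h => ⟨fun σ => (h σ).1, fun σ => (h σ).2⟩⟩

/-- On a finite complex, `IsDiscreteMorseFunction f` is literally the printed condition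
`#{τ ⋗ σ | f τ ≤ f σ} ≤ 1 ∧ #{ν ⋖ σ | f ν ≥ f σ} ≤ 1` for every cell `σ`.
[cite: Forman1998, Def. 2.1] -/
theorem isDiscreteMorseFunction_iff_ncard_le_one [Finite α] {f : α → β} :
    IsDiscreteMorseFunction f ↔ ∀ σ : α, (cofacetsLE f σ).ncard ≤ 1 ∧ (facetsGE f σ).ncard ≤ 1 := by
  simp only [Set.ncard_le_one_iff_subsingleton]
  exact isDiscreteMorseFunction_iff

/-- The definition of a critical cell, unfolded. [cite: Forman1998, Def. 2.2] -/
theorem isCritical_iff {f : α → β} {σ : α} :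
    IsCritical f σ ↔ cofacetsLE f σ = ∅ ∧ facetsGE f σ = ∅ :=
  ⟨fun h => ⟨h.1, h.2⟩, fun h => ⟨h.1, h.2⟩⟩

/-- On a finite complex, `IsCritical f σ` is literally the printed condition
`#{τ ⋗ σ | f τ ≤ f σ} = 0 ∧ #{ν ⋖ σ | f ν ≥ f σ} = 0`. [cite: Forman1998, Def. 2.2] -/
theorem isCritical_iff_ncard_eq_zero [Finite α] {f : α → β} {σ : α} :
    IsCritical f σ ↔ (cofacetsLE f σ).ncard = 0 ∧ (facetsGE f σ).ncard = 0 := by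
  rw [Set.ncard_eq_zero (Set.toFinite _), Set.ncard_eq_zero (Set.toFinite _)]
  exact isCritical_iff

/-- A cell all of whose cofacets have strictly larger and all of whose facets have strictly
smaller `f`-value is critical (for linearly ordered values this is an equivalence,
`isCritical_iff_forall_lt`). [cite: Forman1998, Def. 2.2] -/
theorem isCritical_of_forall_lt {f : α → β} {σ : α} (h₁ : ∀ τ, σ ⋖ τ → f σ < f τ)
    (h₂ : ∀ ν, ν ⋖ σ → f ν < f σ) : IsCritical f σ := by
  refine ⟨Set.eq_empty_of_forall_notMem fun τ hτ => ?_,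
    Set.eq_empty_of_forall_notMem fun ν hν => ?_⟩
  · exact lt_irrefl (f τ) (lt_of_le_of_lt hτ.2 (h₁ τ hτ.1))
  · exact lt_irrefl (f σ) (lt_of_le_of_lt hν.2 (h₂ ν hν.1))

/-- If every cell is critical then `f` is a discrete Morse function (both exceptional sets are
empty, hence have at most one element). [cite: Forman1998, §4, first paragraph] -/
theorem isDiscreteMorseFunction_of_forall_isCritical {f : α → β} (h : ∀ σ, IsCritical f σ) :
    IsDiscreteMorseFunction f :=
  ⟨fun σ => by rw [(h σ).cofacetsLE_eq_empty]; exact Set.subsingleton_empty,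
    fun σ => by rw [(h σ).facetsGE_eq_empty]; exact Set.subsingleton_empty⟩

/-- Every cell is critical for a strictly monotone `f` (Forman's example `f = dim`).
[cite: Forman1998, §4, first paragraph] -/
theorem _root_.StrictMono.isCritical {f : α → β} (hf : StrictMono f) (σ : α) : IsCritical f σ :=
  isCritical_of_forall_lt (fun _ hτ => hf hτ.lt) (fun _ hν => hf hν.lt)

/-- A strictly monotone `f` (Forman's example `f = dim`) is a discrete Morse function, all of
whose cells are critical (`StrictMono.isCritical`). [cite: Forman1998, §4, first paragraph] -/
theorem _root_.StrictMono.isDiscreteMorseFunction {f : α → β} (hf : StrictMono f) :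
    IsDiscreteMorseFunction f :=
  isDiscreteMorseFunction_of_forall_isCritical hf.isCritical

/-- Forman's first example: on a graded poset the rank function `dim = grade` is a discrete
Morse function for which every cell is critical. [cite: Forman1998, §4, first paragraph] -/
theorem isCritical_grade (𝕆 : Type*) [Preorder 𝕆] [GradeOrder 𝕆 α] (σ : α) :
    IsCritical (grade 𝕆 : α → 𝕆) σ :=
  (grade_strictMono (𝕆 := 𝕆) (α := α)).isCritical σ

/-! ### The discrete gradient and discrete vector fields -/

/-- The **discrete gradient vector field** `V_f` of `f`, as a set of pairs of cells: `(σ, τ) ∈ V_f`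
iff `τ` covers `σ` and `f τ ≤ f σ` (Forman sets `V(σ) = ± τ` for the — for a discrete Morse
function unique — such `τ`, and `V(σ) = 0` if there is none; the orientation sign is dropped, as
in §9 of the source, so that `V_f` is a set of pairs, i.e. a partial matching).
[cite: Forman1998, Def. 6.1] -/
def discreteGradient (f : α → β) : Set (α × α) := {e | e.1 ⋖ e.2 ∧ f e.2 ≤ f e.1}

/-- Membership in the discrete gradient unfolds definitionally. [cite: Forman1998, Def. 6.1] -/
@[simp] theorem mem_discreteGradient {f : α → β} {σ τ : α} :
    (σ, τ) ∈ discreteGradient f ↔ σ ⋖ τ ∧ f τ ≤ f σ := Iff.rfl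

/-- `(σ, τ)` is a gradient pair iff `τ` is an exceptional cofacet of `σ`.
[cite: Forman1998, Def. 6.1] -/
theorem mem_discreteGradient_iff_mem_cofacetsLE {f : α → β} {σ τ : α} :
    (σ, τ) ∈ discreteGradient f ↔ τ ∈ cofacetsLE f σ := Iff.rfl

/-- `(σ, τ)` is a gradient pair iff `σ` is an exceptional facet of `τ`.
[cite: Forman1998, Def. 6.1] -/
theorem mem_discreteGradient_iff_mem_facetsGE {f : α → β} {σ τ : α} :
    (σ, τ) ∈ discreteGradient f ↔ σ ∈ facetsGE f τ := Iff.rfl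

/-- A **discrete vector field** on (the face poset `α` of) a regular cell complex: a set `V` of
pairs of cells `(σ, τ)` with `τ` covering `σ` (Forman: a map `W : K → K ∪ {0}` with
`W(K_p) ⊆ K_{p+1} ∪ {0}` and `σ` a face of `W σ`), which is the graph of a partial map
(`eq_of_fst_eq`), injective (`eq_of_snd_eq`, condition (4) of the source), and such that no cell
is both a tail and a head (`fst_ne_snd`, condition (3): `σ ∈ image W → W σ = 0`). Equivalently
(Kozlov 2008, Def. 11.1 (1); `isDiscreteVectorField_iff_pairwise`): a partial matching in the
Hasse diagram of `α`, every cell lying in at most one pair. [cite: Forman1998, Def. 9.1] -/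
structure IsDiscreteVectorField (V : Set (α × α)) : Prop where
  /-- (1)–(2): each pair is a cover `σ ⋖ τ` (a `p`-cell and a `(p+1)`-cell having it as a face). -/
  covBy : ∀ ⦃e : α × α⦄, e ∈ V → e.1 ⋖ e.2
  /-- `V` is (the graph of) a partial map: a cell is the tail of at most one pair. -/
  eq_of_fst_eq : ∀ ⦃e e' : α × α⦄, e ∈ V → e' ∈ V → e.1 = e'.1 → e = e'
  /-- (4): a cell is the head of at most one pair. -/
  eq_of_snd_eq : ∀ ⦃e e' : α × α⦄, e ∈ V → e' ∈ V → e.2 = e'.2 → e = e'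
  /-- (3): no cell is both the tail of a pair and the head of a pair. -/
  fst_ne_snd : ∀ ⦃e e' : α × α⦄, e ∈ V → e' ∈ V → e.1 ≠ e'.2

/-- Kozlov's form of the definition of a discrete vector field: a set of cover pairs such that
every cell belongs to at most one pair (a partial matching in the Hasse diagram; Kozlov 2008,
Def. 11.1 (1)). [cite: Kozlov2008, Def. 11.1] -/
theorem isDiscreteVectorField_iff_pairwise {V : Set (α × α)} : IsDiscreteVectorField V ↔
    (∀ e ∈ V, e.1 ⋖ e.2) ∧ ∀ e ∈ V, ∀ e' ∈ V, ∀ a : α,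
      (a = e.1 ∨ a = e.2) → (a = e'.1 ∨ a = e'.2) → e = e' := by
  constructor
  · rintro ⟨hcov, hfst, hsnd, hne⟩
    refine ⟨fun e he => hcov he, fun e he e' he' a ha ha' => ?_⟩
    rcases ha with rfl | rfl <;> rcases ha' with h | h
    · exact hfst he he' h
    · exact absurd h (hne he he')
    · exact absurd h.symm (hne he' he)
    · exact hsnd he he' h
  · rintro ⟨hcov, h⟩
    refine ⟨fun e he => hcov e he, fun e e' he he' h₁ => h e he e' he' e.1 (Or.inl rfl) (Or.inl h₁),
      fun e e' he he' h₂ => h e he e' he' e.2 (Or.inr rfl) (Or.inr h₂), fun e e' he he' h₁₂ => ?_⟩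
    have hee' : e = e' := h e he e' he' e.1 (Or.inl rfl) (Or.inr h₁₂)
    subst hee'
    exact (hcov e he).lt.ne h₁₂

/-- The **rest cells** of a discrete vector field `V`: the cells occurring in no pair of `V`
(Forman: `W σ = 0` and `σ ∉ image W`; Kozlov's critical elements `C(P, M)`). For the gradient of a
discrete Morse function these are exactly the critical cells (`criticalCells_eq_unmatched`).
[cite: Forman1998, Thm. 9.3, Remark] -/
def unmatched (V : Set (α × α)) : Set α := {σ | ∀ e ∈ V, e.1 ≠ σ ∧ e.2 ≠ σ}

omit [Preorder α] in
/-- Membership in `unmatched` unfolds definitionally. [cite: Forman1998, Thm. 9.3, Remark] -/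
@[simp] theorem mem_unmatched {V : Set (α × α)} {σ : α} :
    σ ∈ unmatched V ↔ ∀ e ∈ V, e.1 ≠ σ ∧ e.2 ≠ σ := Iff.rfl

/-- A cell is critical for `f` iff it lies in no pair of the discrete gradient of `f`
(`σ ∉ image V` and `V σ = 0`). [cite: Forman1998, Thm. 6.3 (3)] -/
theorem isCritical_iff_mem_unmatched {f : α → β} {σ : α} :
    IsCritical f σ ↔ σ ∈ unmatched (discreteGradient f) := by
  constructor
  · rintro ⟨h₁, h₂⟩ ⟨a, b⟩ he
    refine ⟨fun ha => ?_, fun hb => ?_⟩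
    · subst ha
      have hb : b ∈ cofacetsLE f a := he
      rw [h₁] at hb
      exact hb
    · subst hb
      have ha : a ∈ facetsGE f b := he
      rw [h₂] at ha
      exact ha
  · intro h
    refine ⟨Set.eq_empty_of_forall_notMem fun τ hτ => ?_,
      Set.eq_empty_of_forall_notMem fun ν hν => ?_⟩
    · exact (h (σ, τ) hτ).1 rfl
    · exact (h (ν, σ) hν).2 rfl

/-- The critical cells of `f` are the rest cells of its discrete gradient.
[cite: Forman1998, Thm. 6.3 (3)] -/
theorem criticalCells_eq_unmatched (f : α → β) :
    criticalCells f = unmatched (discreteGradient f) :=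
  Set.ext fun _ => isCritical_iff_mem_unmatched

/-! ### `V`-paths and acyclicity -/

/-- One **non-stationary step** `σ → σ'` of a `V`-path of a discrete vector field `V`: `σ` is the
tail of a pair `(σ, τ) ∈ V` and `σ'` is a cell covered by `τ = V σ` other than `σ`
(condition (ii) of the source: `σᵢ₊₁ ≠ σᵢ` and `σᵢ₊₁ < V(σᵢ)`; the stationary steps `σᵢ₊₁ = σᵢ` at
rest cells, condition (i), are not recorded). [cite: Forman1998, Def. 9.2] -/
def VStep (V : Set (α × α)) (σ σ' : α) : Prop := ∃ τ, (σ, τ) ∈ V ∧ σ' ⋖ τ ∧ σ' ≠ σ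

/-- A (non-degenerate) **`V`-path** `σ₀ → σ₁ → ⋯ → σᵣ`: a list of cells each obtained from the
previous one by a non-stationary step `VStep V`. [cite: Forman1998, Def. 9.2] -/
def IsVPath (V : Set (α × α)) (l : List α) : Prop := l.IsChain (VStep V)

/-- A discrete vector field is **acyclic** if it has no non-stationary closed `V`-path
`σ₀ → σ₁ → ⋯ → σᵣ = σ₀`, `r ≥ 1` — the condition characterising the gradient vector fields of
discrete Morse functions (Forman 1998, Thm. 9.3; Kozlov's acyclic matchings, Def. 11.1 (2)).
Stated as irreflexivity of the transitive closure of `VStep V`; the path form is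
`isAcyclic_iff_forall_isVPath`. [cite: Forman1998, Thm. 9.3] -/
def IsAcyclic (V : Set (α × α)) : Prop := ∀ σ : α, ¬ Relation.TransGen (VStep V) σ σ

/-- `IsAcyclic V` says literally that no `V`-path with at least one (non-stationary) step returns
to its starting cell. [cite: Forman1998, Thm. 9.3] -/
theorem isAcyclic_iff_forall_isVPath {V : Set (α × α)} : IsAcyclic V ↔
    ∀ (σ : α) (l : List α), l ≠ [] → IsVPath V (σ :: l) →
      (σ :: l).getLast (List.cons_ne_nil σ l) ≠ σ := by
  constructor
  · intro h σ l hl hpath hlast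
    cases l with
    | nil => exact hl rfl
    | cons b l =>
      have hc : VStep V σ b ∧ List.IsChain (VStep V) (b :: l) := List.isChain_cons_cons.mp hpath
      have hlast' : (b :: l).getLast (List.cons_ne_nil b l) = σ := by
        rwa [List.getLast_cons_cons] at hlast
      exact h σ (Relation.TransGen.head'_iff.mpr
        ⟨b, hc.1, List.relationReflTransGen_of_exists_isChain_cons l hc.2 hlast'⟩)
  · intro h σ hσ
    obtain ⟨b, hσb, hbσ⟩ := Relation.TransGen.head'_iff.mp hσ
    obtain ⟨l, hchain, hlast⟩ := List.exists_isChain_cons_of_relationReflTransGen hbσ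
    refine h σ (b :: l) (List.cons_ne_nil b l) (List.isChain_cons_cons.mpr ⟨hσb, hchain⟩) ?_
    rwa [List.getLast_cons_cons]

/-! ### The diamond property of face posets of regular complexes -/

/-- The **cover-diamond property** of a poset of cells: whenever `ν ⋖ σ ⋖ τ` (a `(p-1)`-face of
a `p`-face of a `(p+1)`-cell) there is a second `p`-cell `σ' ≠ σ` with `ν ⋖ σ' ⋖ τ`. Forman
proves it for CW complexes in which `ν ⋖ σ` and `σ ⋖ τ` are regular faces, in particular for all
regular CW complexes (where, moreover, `σ'` is unique: intervals of length two in the face poset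
are diamonds). [cite: Forman1998, Thm. 1.2 (iii)] -/
def HasCoverDiamonds (α : Type*) [Preorder α] : Prop :=
  ∀ ⦃ν σ τ : α⦄, ν ⋖ σ → σ ⋖ τ → ∃ σ' : α, σ' ≠ σ ∧ ν ⋖ σ' ∧ σ' ⋖ τ

/-- The face poset of a simplex — the Boolean lattice `Finset γ` ordered by inclusion, the empty
face included — has the cover-diamond property: if `σ = insert a ν` and `τ = insert b σ` then
`σ' = insert b ν` is the second flank of the diamond. (Hence so does every abstract simplicial
complex, a lower set of `Finset γ`, since `σ' ⊆ τ`.) [folklore] -/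
theorem hasCoverDiamonds_finset {γ : Type*} [DecidableEq γ] : HasCoverDiamonds (Finset γ) := by
  intro ν σ τ hνσ hστ
  obtain ⟨a, haν, rfl⟩ := Finset.covBy_iff_exists_insert.mp hνσ
  obtain ⟨b, hbσ, rfl⟩ := Finset.covBy_iff_exists_insert.mp hστ
  have hba : b ≠ a := fun h => hbσ (h ▸ Finset.mem_insert_self a ν)
  have hbν : b ∉ ν := fun h => hbσ (Finset.mem_insert_of_mem h)
  refine ⟨insert b ν, fun h => hbσ (h ▸ Finset.mem_insert_self b ν),
    Finset.covBy_iff_exists_insert.mpr ⟨b, hbν, rfl⟩,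
    Finset.covBy_iff_exists_insert.mpr ⟨a, ?_, Finset.insert_comm a b ν⟩⟩
  simp only [Finset.mem_insert, not_or]
  exact ⟨hba.symm, haν⟩

end Definitions

/-! ### Consequences for linearly ordered values (Forman: `β = ℝ`) -/

section LinearOrder

variable {α : Type*} {β : Type*} [Preorder α] [LinearOrder β] {f : α → β}

/-- For linearly ordered values, `σ` is critical iff `f σ < f τ` for every cofacet `τ ⋗ σ` and
`f ν < f σ` for every facet `ν ⋖ σ`. [cite: Forman1998, Def. 2.2] -/
theorem isCritical_iff_forall_lt {σ : α} :
    IsCritical f σ ↔ (∀ τ, σ ⋖ τ → f σ < f τ) ∧ (∀ ν, ν ⋖ σ → f ν < f σ) := by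
  refine ⟨fun h => ⟨fun τ hτ => ?_, fun ν hν => ?_⟩, fun h => isCritical_of_forall_lt h.1 h.2⟩
  · by_contra hlt
    have hmem : τ ∈ cofacetsLE f σ := ⟨hτ, not_lt.mp hlt⟩
    rw [h.cofacetsLE_eq_empty] at hmem
    exact hmem
  · by_contra hlt
    have hmem : ν ∈ facetsGE f σ := ⟨hν, not_lt.mp hlt⟩
    rw [h.facetsGE_eq_empty] at hmem
    exact hmem

/-- A cell `σ` is NOT critical iff either (i) some cofacet `τ ⋗ σ` has `f τ ≤ f σ`, or (ii) some
facet `ν ⋖ σ` has `f ν ≥ f σ`. [cite: Forman1998, §2, p. 102] -/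
theorem not_isCritical_iff {σ : α} :
    ¬ IsCritical f σ ↔ (∃ τ, σ ⋖ τ ∧ f τ ≤ f σ) ∨ (∃ ν, ν ⋖ σ ∧ f σ ≤ f ν) := by
  simp only [isCritical_iff_forall_lt, not_and_or, not_forall, not_lt, exists_prop]

/-- For a discrete Morse function, every facet of `σ` other than an exceptional one has strictly
smaller value. [cite: Forman1998, Def. 2.1] -/
theorem IsDiscreteMorseFunction.lt_of_mem_facetsGE (hf : IsDiscreteMorseFunction f) {σ ν ν' : α}
    (hν : ν ∈ facetsGE f σ) (hν' : ν' ⋖ σ) (hne : ν' ≠ ν) : f ν' < f σ := by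
  by_contra hlt
  exact hne (hf.subsingleton_facetsGE σ ⟨hν', not_lt.mp hlt⟩ hν)

/-- For a discrete Morse function, every cofacet of `σ` other than an exceptional one has
strictly larger value. [cite: Forman1998, Def. 2.1] -/
theorem IsDiscreteMorseFunction.lt_of_mem_cofacetsLE (hf : IsDiscreteMorseFunction f) {σ τ τ' : α}
    (hτ : τ ∈ cofacetsLE f σ) (hτ' : σ ⋖ τ') (hne : τ' ≠ τ) : f σ < f τ' := by
  by_contra hlt
  exact hne (hf.subsingleton_cofacetsLE σ ⟨hτ', not_lt.mp hlt⟩ hτ)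

/-- **Forman's Lemma 2.5.** On a poset with the cover-diamond property (e.g. the face poset of a
regular CW complex), no cell of a discrete Morse function has both an exceptional cofacet
(`τ ⋗ σ` with `f τ ≤ f σ`) and an exceptional facet (`ν ⋖ σ` with `f ν ≥ f σ`): the second flank
`ν ⋖ σ' ⋖ τ` of the diamond would give `f σ ≤ f ν < f σ' < f τ ≤ f σ`.
[cite: Forman1998, Lemma 2.5] -/
theorem IsDiscreteMorseFunction.cofacetsLE_eq_empty_or_facetsGE_eq_empty
    (hf : IsDiscreteMorseFunction f) (hα : HasCoverDiamonds α) (σ : α) :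
    cofacetsLE f σ = ∅ ∨ facetsGE f σ = ∅ := by
  by_contra h
  rw [not_or] at h
  obtain ⟨τ, hτ⟩ := Set.nonempty_iff_ne_empty.mpr h.1
  obtain ⟨ν, hν⟩ := Set.nonempty_iff_ne_empty.mpr h.2
  obtain ⟨σ', hne, hνσ', hσ'τ⟩ := hα hν.1 hτ.1
  have h₁ : f σ' < f τ := hf.lt_of_mem_facetsGE (σ := τ) (ν := σ) ⟨hτ.1, hτ.2⟩ hσ'τ hne
  have h₂ : f ν < f σ' := hf.lt_of_mem_cofacetsLE (σ := ν) (τ := σ) ⟨hν.1, hν.2⟩ hνσ' hne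
  exact lt_irrefl (f σ) (lt_of_le_of_lt hν.2 (h₂.trans (h₁.trans_le hτ.2)))

/-- The discrete gradient of a discrete Morse function on a poset with the cover-diamond property
is a discrete vector field: a cell is the tail of at most one gradient pair (condition (i) of
Def. 2.1), the head of at most one (condition (ii); Thm. 6.3 (2)), and never both (Lemma 2.5;
Thm. 6.3 (1), `V ∘ V = 0`). [cite: Forman1998, Thm. 6.3] -/
theorem IsDiscreteMorseFunction.isDiscreteVectorField_discreteGradient
    (hf : IsDiscreteMorseFunction f) (hα : HasCoverDiamonds α) :
    IsDiscreteVectorField (discreteGradient f) := by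
  refine ⟨fun e he => he.1, ?_, ?_, ?_⟩
  · rintro ⟨a, b⟩ ⟨a', b'⟩ he he' (h : a = a')
    subst h
    obtain rfl : b = b' := hf.subsingleton_cofacetsLE a he he'
    rfl
  · rintro ⟨a, b⟩ ⟨a', b'⟩ he he' (h : b = b')
    subst h
    obtain rfl : a = a' := hf.subsingleton_facetsGE b he he'
    rfl
  · rintro ⟨a, b⟩ ⟨a', b'⟩ he he' (h : a = b')
    have hb : (cofacetsLE f a).Nonempty := ⟨b, he⟩
    have ha : (facetsGE f b').Nonempty := ⟨a', he'⟩
    rw [h] at hb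
    rcases hf.cofacetsLE_eq_empty_or_facetsGE_eq_empty hα b' with h0 | h0
    · exact hb.ne_empty h0
    · exact ha.ne_empty h0

/-- Along a non-stationary step `σ → σ'` of a gradient path of a discrete Morse function the value
strictly decreases: `f σ' < f (V σ) ≤ f σ`. [cite: Forman1998, Thm. 9.3] -/
theorem IsDiscreteMorseFunction.lt_of_vStep (hf : IsDiscreteMorseFunction f) {σ σ' : α}
    (h : VStep (discreteGradient f) σ σ') : f σ' < f σ := by
  obtain ⟨τ, hστ, hσ'τ, hne⟩ := h
  exact (hf.lt_of_mem_facetsGE (σ := τ) (ν := σ) hστ hσ'τ hne).trans_le hστ.2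

/-- Along a `V_f`-path with at least one non-stationary step the value strictly decreases, for a
discrete Morse function `f`. [cite: Forman1998, Thm. 9.3] -/
theorem IsDiscreteMorseFunction.lt_of_transGen_vStep (hf : IsDiscreteMorseFunction f) {σ σ' : α}
    (h : Relation.TransGen (VStep (discreteGradient f)) σ σ') : f σ' < f σ := by
  induction h with
  | single h => exact hf.lt_of_vStep h
  | tail _ h ih => exact (hf.lt_of_vStep h).trans ih

/-- **The gradient of a discrete Morse function is acyclic** (the "only if" half of Forman's
characterisation of gradient vector fields): there is no non-stationary closed `V_f`-path,
because `f` strictly decreases along non-stationary steps. [cite: Forman1998, Thm. 9.3] -/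
theorem IsDiscreteMorseFunction.isAcyclic_discreteGradient (hf : IsDiscreteMorseFunction f) :
    IsAcyclic (discreteGradient f) :=
  fun _ hσ => lt_irrefl _ (hf.lt_of_transGen_vStep hσ)

end LinearOrder

end Literature.AlgebraicTopology.DiscreteMorseTheory
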